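import Summits.KontsevichZagierPeriods.KontsevichZagierPeriods.Theorems.EllipticMomentKernel.Negative.VerticalBand

/-!
# `EllipticMomentKernel` (stmt-KontsevichZagierPeriods-10631) — negative knowledge, part 9b: `stub_verticalDescent` holds for every admissible parameter

Continuation of part 9a (`VerticalBand.lean`): the passage from the closed vertical band to the
open region `D = underGraph` is ONE domain-additivity move across the two null graphs `y = 0`,
`y = √f(x)` (`vEnds`; null by Tonelli, `volume_graph_eq_zero`), whence
`verticalDescent : ∃ s, s.domain = σ ∧ s.integrand = x^a √f^{b+1}/(b+1) on σ ∧ [r] − [s] ∈ relations`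
for every representation `r` of `[D, x^a y^b]` — the registered skeleton's `stub_verticalDescent`
with its decorative hypothesis `hσ : IsSemialgebraic ℚ σ` dropped (standing-adversary certificate:
the stub cannot be broken because it is true). By part 3 (`DimEval`) no derivation of this
congruence avoids rule 3. [folklore]
-/

noncomputable section

open MeasureTheory Set
open scoped BigOperators

namespace Summit.KontsevichZagierPeriods.HermiteRigidity.EllipticMomentKernelNegative

open Literature.NumberTheory.Transcendental
open Literature.NumberTheory.Transcendental.KZ

section VerticalDescent

open Literature.ModelTheory.ExponentialFields (IsSemialgebraic isSemialgebraic_setOf_eval_pos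
  isSemialgebraic_setOf_eval_eq_zero isSemialgebraic_univ)
open MvPolynomial (aeval X C)

variable {q₂ q₃ : ℚ}

/-! ### The (1a) passage: closed vertical band versus the open region `D` (two null graphs) -/

/-- Graphs of measurable functions are Lebesgue-null in `ℝ²` (Tonelli: every vertical slice is a
point). [folklore] -/
theorem volume_graph_eq_zero {g : ℝ → ℝ} (hg : Measurable g) :
    volume {z : Fin 2 → ℝ | z 1 = g (z 0)} = 0 := by
  have e := MeasureTheory.volume_preserving_finTwoArrow ℝ
  have hmeas : MeasurableSet {p : ℝ × ℝ | p.2 = g p.1} :=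
    measurableSet_eq_fun measurable_snd (hg.comp measurable_fst)
  have hset : {z : Fin 2 → ℝ | z 1 = g (z 0)} =
      MeasurableEquiv.finTwoArrow ⁻¹' {p : ℝ × ℝ | p.2 = g p.1} := by
    ext z; simp
  rw [hset, e.measure_preimage hmeas.nullMeasurableSet, Measure.volume_eq_prod,
    Measure.prod_apply hmeas]
  have hslice : ∀ x : ℝ, volume (Prod.mk x ⁻¹' {p : ℝ × ℝ | p.2 = g p.1}) = 0 := by
    intro x
    have : Prod.mk x ⁻¹' {p : ℝ × ℝ | p.2 = g p.1} = {g x} := by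
      ext y; simp
    rw [this, Real.volume_singleton]
  simp only [hslice, lintegral_zero]

/-- The two null graphs separating the closed band from `D`: `y = 0` and `y = √f(x)` over `σ`.
[folklore] -/
def vEnds (q₂ q₃ : ℚ) : Set (Fin 2 → ℝ) :=
  {z | (Fin.init z : Fin 1 → ℝ) ∈ oval q₂ q₃ ∧ (z 1 = 0 ∨ z 1 = Real.sqrt (cubic q₂ q₃ (z 0)))}

/-- `vEnds` is Lebesgue-null. [folklore] -/
theorem volume_vEnds (q₂ q₃ : ℚ) : volume (vEnds q₂ q₃) = 0 := by
  have h0 := volume_graph_eq_zero (g := fun _ => (0 : ℝ)) measurable_const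
  have h1 := volume_graph_eq_zero (g := fun x => Real.sqrt (cubic q₂ q₃ x))
    (Real.continuous_sqrt.comp continuous_cubic).measurable
  apply measure_mono_null (t := {z : Fin 2 → ℝ | z 1 = (fun _ => (0 : ℝ)) (z 0)} ∪
    {z : Fin 2 → ℝ | z 1 = Real.sqrt (cubic q₂ q₃ (z 0))}) ?_ (measure_union_null h0 h1)
  rintro z ⟨-, hz | hz⟩
  · exact Or.inl hz
  · exact Or.inr hz

/-- `vEnds` is `ℚ`-semialgebraic (`y = 0`, or `y ≥ 0 ∧ y² = f(x)`, over the cylinder on `σ`).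
[folklore] -/
theorem isSemialgebraic_vEnds (h : 0 < disc q₂ q₃) : IsSemialgebraic ℚ (vEnds q₂ q₃) := by
  have h1 : IsSemialgebraic ℚ {z : Fin 2 → ℝ | (Fin.init z : Fin 1 → ℝ) ∈ oval q₂ q₃} :=
    (isSemialgebraic_oval h).setOf_init_mem
  have h2 := isSemialgebraic_setOf_eval_eq_zero (k := ℚ) (R := ℝ) (X 1 : MvPolynomial (Fin 2) ℚ)
  have h3 := isSemialgebraic_setOf_eval_eq_zero (k := ℚ) (R := ℝ)
    (cubicPoly₂ q₂ q₃ - X 1 ^ 2 : MvPolynomial (Fin 2) ℚ)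
  have h4 : IsSemialgebraic ℚ {z : Fin 2 → ℝ | 0 ≤ z 1} := by
    have ha := isSemialgebraic_setOf_eval_pos (k := ℚ) (R := ℝ) (X 1 : MvPolynomial (Fin 2) ℚ)
    convert ha.union h2 using 1
    ext z
    simp only [mem_setOf_eq, mem_union, MvPolynomial.aeval_X]
    constructor
    · intro hz
      rcases hz.lt_or_eq with hz | hz
      · exact Or.inl hz
      · exact Or.inr hz.symm
    · rintro (hz | hz)
      · exact hz.le
      · exact hz.ge
  convert h1.inter (h2.union (h4.inter h3)) using 1
  ext z
  simp only [vEnds, mem_setOf_eq, mem_inter_iff, mem_union, MvPolynomial.aeval_X, map_sub, map_pow,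
    aeval_cubicPoly₂]
  constructor
  · rintro ⟨hσ, hz | hz⟩
    · exact ⟨hσ, Or.inl hz⟩
    · refine ⟨hσ, Or.inr ⟨?_, ?_⟩⟩
      · rw [hz]; exact Real.sqrt_nonneg _
      · have hf : 0 ≤ cubic q₂ q₃ (z 0) := hσ.1.le
        rw [hz, Real.sq_sqrt hf]; ring
  · rintro ⟨hσ, hz | ⟨hz0, hz⟩⟩
    · exact ⟨hσ, Or.inl hz⟩
    · refine ⟨hσ, Or.inr ?_⟩
      have hf : 0 ≤ cubic q₂ q₃ (z 0) := hσ.1.le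
      have : z 1 ^ 2 = cubic q₂ q₃ (z 0) := by linarith
      rw [← this, Real.sqrt_sq hz0]

/-- `vBand = D ∪ vEnds`. [folklore] -/
theorem vBand_eq_union (q₂ q₃ : ℚ) : vBand q₂ q₃ = underGraph q₂ q₃ ∪ vEnds q₂ q₃ := by
  ext z
  simp only [mem_vBand_iff, underGraph, vEnds, mem_union, mem_setOf_eq]
  constructor
  · rintro ⟨hσ, h0, hle⟩
    have hσ' : 0 < cubic q₂ q₃ (z 0) ∧ ∃ t : ℝ, z 0 < t ∧ cubic q₂ q₃ t < 0 := hσ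
    rcases h0.lt_or_eq with h0 | h0
    · rcases hle.lt_or_eq with hle | hle
      · left
        refine ⟨hσ', h0, ?_⟩
        calc z 1 ^ 2 < Real.sqrt (cubic q₂ q₃ (z 0)) ^ 2 := by gcongr
          _ = cubic q₂ q₃ (z 0) := Real.sq_sqrt hσ'.1.le
      · exact Or.inr ⟨hσ, Or.inr hle⟩
    · exact Or.inr ⟨hσ, Or.inl h0.symm⟩
  · rintro (⟨hσ, h0, hlt⟩ | ⟨hσ, hz | hz⟩)
    · refine ⟨hσ, h0.le, ?_⟩
      exact (Real.lt_sqrt h0.le).2 hlt |>.le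
    · have hσ' : 0 < cubic q₂ q₃ (z 0) ∧ ∃ t : ℝ, z 0 < t ∧ cubic q₂ q₃ t < 0 := hσ
      exact ⟨hσ, hz.ge, by rw [hz]; exact Real.sqrt_nonneg _⟩
    · exact ⟨hσ, by rw [hz]; exact Real.sqrt_nonneg _, hz.le⟩

/-- `D` and `vEnds` are disjoint. [folklore] -/
theorem underGraph_inter_vEnds (q₂ q₃ : ℚ) : underGraph q₂ q₃ ∩ vEnds q₂ q₃ = ∅ := by
  ext z
  simp only [underGraph, vEnds, mem_inter_iff, mem_setOf_eq, mem_empty_iff_false, iff_false]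
  rintro ⟨⟨hσ, h0, hlt⟩, -, hz | hz⟩
  · rw [hz] at h0; exact lt_irrefl _ h0
  · rw [hz, Real.sq_sqrt hσ.1.le] at hlt; exact lt_irrefl _ hlt

/-- The moment restricted to the null graphs, as a representation. [folklore] -/
def vEndsRep (h : 0 < disc q₂ q₃) (a b : ℕ) : IntegralRep 2 where
  domain := vEnds q₂ q₃
  integrand := fun p => p 0 ^ a * p 1 ^ b
  isSemialgebraic_domain := isSemialgebraic_vEnds h
  isSemialgebraicFunOn_integrand :=
    (isSemialgebraicFunOn_aeval (isSemialgebraic_vEnds h)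
      (X 0 ^ a * X 1 ^ b : MvPolynomial (Fin 2) ℚ)).congr fun p _ => by simp
  integrableOn := by
    rw [IntegrableOn, Measure.restrict_eq_zero.2 (volume_vEnds q₂ q₃)]
    exact integrable_zero_measure

/-- A representation on a null domain is a relation (`[N] − [N] − [N] ∈ domainAddRel`). [folklore] -/
theorem of_vEndsRep_mem_relations (h : 0 < disc q₂ q₃) (a b : ℕ) :
    KZ.of (vEndsRep h a b) ∈ relations := by
  have hmem : KZ.of (vEndsRep h a b) - KZ.of (vEndsRep h a b) - KZ.of (vEndsRep h a b) ∈
      domainAddRel :=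
    ⟨2, vEndsRep h a b, vEndsRep h a b, vEndsRep h a b, (union_self _).symm,
      by rw [inter_self]; exact volume_vEnds q₂ q₃, fun _ _ => rfl, fun _ _ => rfl, rfl⟩
  have h' := domainAddRel_subset_relations hmem
  have : KZ.of (vEndsRep h a b) =
      -(KZ.of (vEndsRep h a b) - KZ.of (vEndsRep h a b) - KZ.of (vEndsRep h a b)) := by abel
  rw [this]
  exact relations.neg_mem h'

/-- **`stub_verticalDescent`, PROVED for every admissible parameter** (with the skeleton's
decorative hypothesis `hσ : IsSemialgebraic ℚ σ` dropped): for every representation `r` of the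
moment `[D, x^a y^b]` there is a representation `s = [σ, x^a √f^{b+1}/(b+1)]` with
`[r] − [s] ∈ KZ.relations` — ONE (1a) move `[vBand] − [r] − [vEnds]` (null overlap `D ∩ vEnds = ∅`),
the null representation `[vEnds] ~ 0`, and the rule-3 move
`of_vBandRep_sub_of_vBaseRep_mem_newtonLeibnizRel`. Over the vocabulary of this file
(`oval/underGraph/cubic/disc`, definitionally equal to the `EllipticMomentKernelNegative` copies).
[cite: KontsevichZagier2001, §1.2 rules (1) and (3)] -/
theorem verticalDescent (h : 0 < disc q₂ q₃) (a b : ℕ) (r : IntegralRep 2)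
    (hr : r.domain = underGraph q₂ q₃)
    (hri : EqOn r.integrand (fun p => p 0 ^ a * p 1 ^ b) (underGraph q₂ q₃)) :
    ∃ s : IntegralRep 1, s.domain = oval q₂ q₃ ∧
      EqOn s.integrand (fun p => p 0 ^ a * Real.sqrt (cubic q₂ q₃ (p 0)) ^ (b + 1) / ((b : ℝ) + 1))
        (oval q₂ q₃) ∧
      KZ.of r - KZ.of s ∈ relations := by
  refine ⟨vBaseRep h a b, rfl, fun _ _ => rfl, ?_⟩
  -- the (1a) move
  have h1a : KZ.of (vBandRep h a b) - KZ.of r - KZ.of (vEndsRep h a b) ∈ domainAddRel := by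
    refine ⟨2, vBandRep h a b, r, vEndsRep h a b, ?_, ?_, ?_, fun _ _ => rfl, rfl⟩
    · show vBand q₂ q₃ = r.domain ∪ vEnds q₂ q₃
      rw [hr, vBand_eq_union]
    · show volume (r.domain ∩ vEnds q₂ q₃) = 0
      rw [hr, underGraph_inter_vEnds, measure_empty]
    · intro z hz
      rw [hr] at hz
      exact (hri hz).symm
  have hA := domainAddRel_subset_relations h1a
  have hB := of_vEndsRep_mem_relations h a b
  have hC := of_vBandRep_sub_of_vBaseRep_mem_relations h a b
  have : KZ.of r - KZ.of (vBaseRep h a b) =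
      (KZ.of (vBandRep h a b) - KZ.of (vBaseRep h a b)) -
        (KZ.of (vBandRep h a b) - KZ.of r - KZ.of (vEndsRep h a b)) - KZ.of (vEndsRep h a b) := by
    abel
  rw [this]
  exact relations.sub_mem (relations.sub_mem hC hA) hB


end VerticalDescent

end Summit.KontsevichZagierPeriods.HermiteRigidity.EllipticMomentKernelNegative
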